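import Summits.AtomisticToContinuum.FouriersLaw.Theses.BondHeatUncertainty
import Literature.MathematicalPhysics.KineticTheory.LangevinChainReversal
import Literature.Probability.Entropy.FluctuationTheoremUncertainty
import Summits.AtomisticToContinuum.FouriersLaw.Theorems.BondHeatUncertaintyLinearResponseFTURPathLebesgueDuality
import Summits.AtomisticToContinuum.FouriersLaw.Theorems.BondHeatUncertaintyLinearResponseFTUREquilibriumBondHeatVariance

/-!
# drefute g2 certificate — the landed K1 / K6a theorems close the skeleton's slots BY `exact`

refuter-drefute-stmt-AtomisticToContinuum-9122-g2-0, 2026-08-16. Crux stmt-AtomisticToContinuum-9122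
(`BondHeatUncertainty.LinearResponseFTUR`), line `lebesgue-flip-duality`, skeleton sha 33fe20f9….

The skeleton `Lines/lebesgue-flip-duality.lean` states its seven `stub_*` over ITS OWN copies of the
vocabulary (`Obs`, `swapObs`, `flipObs`, `leftHeat`, `rightHeat`, `workIntegral`, `bondHeat`, `rawObs`,
`fwdPath`, `revPath`, `fluxLaw`, `eqCurrentAutocorr`, `bondHeatVariance`, namespace
`…Cruxes.LinearResponseFTUR.LebesgueFlipDuality`), while the landed stub files state them over the
byte-identical copies of `Theorems/BondHeatUncertaintyDefs.lean` (namespace `…Theorems.BondHeatUncertainty`).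
Joint-sufficiency check of the ASSEMBLY path: below, a THIRD byte-identical copy of the vocabulary (this
namespace) and the skeleton's K1 and K6a statements over it, each closed by the bare landed constant —
`Theorems.LinearResponseFTUR.stub_pathLebesgueDuality` (K1, landed 04:05Z) and
`Theorems.LinearResponseFTUR.stub_equilibriumBondHeatVariance` (K6a, landed 05:09Z). `lean check`: rc 0,
0 sorry. So the vocabulary duplication is defeq-transparent (δ-unfolding), and the kernel-checked
composition `lineComposition` of the skeleton (axioms propext / Classical.choice / Quot.sound, 7 → now 5
open slots: K3, K4, rates, K6b, Clausius) accepts the landed theorems as they are. (The same was checked on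
the full skeleton: `Bridge.lean` in the refuter folder = skeleton + the two `exact`s, rc 0, 5 sorries.)
-/

noncomputable section

namespace Summit.AtomisticToContinuum.FouriersLaw.Cruxes.LinearResponseFTUR.DrefuteG2Bridge

open MeasureTheory ProbabilityTheory Filter Topology
open scoped NNReal ENNReal
open Literature.MathematicalPhysics.KineticTheory
open Literature.MathematicalPhysics.KineticTheory.HeatConduction
open Literature.Probability.Process
open Summit.AtomisticToContinuum.FouriersLaw.Theses.BondHeatUncertainty

/-! ## Vocabulary (explicit abbreviations) -/

/-- The observable space `(x_0, x_t, I_L, I_R, Q^b)`: endpoints of a path on `[0, t]`, the two work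
integrals of the thermostatted momenta and the heat through one bond. -/
abbrev Obs (N : ℕ) : Type := PhaseSpace N × PhaseSpace N × ℝ × ℝ × ℝ

/-- Pure time reversal on `Obs N`: endpoints swap, the three integrals are invariant. -/
def swapObs (N : ℕ) (p : Obs N) : Obs N := (p.2.1, p.1, p.2.2)

/-- Time reversal ∘ momentum flip `Θ̃` on `Obs N`: `(x, y, u, v, e) ↦ (Θ y, Θ x, -u, -v, -e)`. -/
def flipObs (N : ℕ) (p : Obs N) : Obs N :=
  ((p.2.1.1, -p.2.1.2), (p.1.1, -p.1.2), -p.2.2.1, -p.2.2.2.1, -p.2.2.2.2)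

/-- Heat absorbed from the bath at site `i0` read off `Obs N`: `p_{i0}(t)²/2 - p_{i0}(0)²/2 + I_L`. -/
def leftHeat {N : ℕ} (i0 : Fin N) (p : Obs N) : ℝ :=
  p.2.1.2 i0 ^ 2 / 2 - p.1.2 i0 ^ 2 / 2 + p.2.2.1

/-- Heat absorbed from the bath at site `iN` read off `Obs N`: `p_{iN}(t)²/2 - p_{iN}(0)²/2 + I_R`. -/
def rightHeat {N : ℕ} (iN : Fin N) (p : Obs N) : ℝ :=
  p.2.1.2 iN ^ 2 / 2 - p.1.2 iN ^ 2 / 2 + p.2.2.2.1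

/-- Work integral of the momentum at site `i` against the Hamiltonian force along a path `X`:
`I_i(X) = ∫₀ᵗ p_i(s) ∂_{q_i}H(X(s)) ds` (so that the heat from a bath at `i` is `Δ(p_i²/2) + I_i`,
no stochastic integral). -/
def workIntegral (P : OscillatorChain) (N : ℕ) (i : Fin N) (t : ℝ) (X : ℝ → PhaseSpace N) : ℝ :=
  ∫ s in (0 : ℝ)..t, (X s).2 i * partialQ i (P.hamiltonian N) (X s)

/-- Heat through bond `(i, i+1)` along a path: `Q^{(i)}(X) = ∫₀ᵗ j_i(X(s)) ds`. -/
def bondHeat (P : OscillatorChain) (N : ℕ) (i : Fin N) (t : ℝ) (X : ℝ → PhaseSpace N) : ℝ :=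
  ∫ s in (0 : ℝ)..t, P.bondCurrent N i (X s)

/-- The raw observable of a path `X` started at `z`: `(z, X t, I_{i0}, I_{iN}, Q^{(ib)})`. -/
def rawObs (P : OscillatorChain) (N : ℕ) (i0 iN ib : Fin N) (t : ℝ) (z : PhaseSpace N)
    (X : ℝ → PhaseSpace N) : Obs N :=
  (z, X t, workIntegral P N i0 t X, workIntegral P N iN t X, bondHeat P N ib t X)

/-- The forward (damped) path from `z` driven by the Brownian pair of the raw sample `w`
(`OscillatorChain.solMap`, the flow behind `OscillatorChain.transitionKernel`). -/
def fwdPath (P : OscillatorChain) (N : ℕ) (T_L T_R : ℝ) (z : PhaseSpace N) (w : WienerPair) :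
    ℝ → PhaseSpace N :=
  fun s => P.solMap N T_L T_R s z (pairPath w)

/-- The reversed-drift path from `y`: the flow of `dz = -Y(z) dt + v_L dB^L + v_R dB^R` (the flow
behind `OscillatorChain.langevinRevKernel`; its `Θ`-conjugate is the ANTI-damped chain). -/
def revPath (P : OscillatorChain) (N : ℕ) (T_L T_R : ℝ) (y : PhaseSpace N) (w : WienerPair) :
    ℝ → PhaseSpace N :=
  fun s => sdeSolMap (fun x => -P.drift N x) (P.bathVecL N T_L) (P.bathVecR N T_R) s y (pairPath w)

/-- The law on `Obs N` of the raw observable of the forward process on `[0, t]` started from `μ`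
(for the NESS `μ_δ`: the endpoint–heat marginal of the stationary path measure `P_δ`). -/
def fluxLaw (P : OscillatorChain) (N : ℕ) (i0 iN ib : Fin N) (T_L T_R t : ℝ)
    (μ : Measure (PhaseSpace N)) : Measure (Obs N) :=
  (μ.prod wienerPair).map fun zw => rawObs P N i0 iN ib t zw.1 (fwdPath P N T_L T_R zw.1 zw.2)

/-- The equilibrium current autocorrelation `C_N(b,s)` of the crux (verbatim). -/
def eqCurrentAutocorr (ω₂ lam β γ T : ℝ) (N b : ℕ) (s : ℝ) : ℝ :=
  if h : b < N then
    ∫ z, (pinnedChain ω₂ lam β γ).bondCurrent N ⟨b, h⟩ z *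
        (∫ y, (pinnedChain ω₂ lam β γ).bondCurrent N ⟨b, h⟩ y
          ∂((pinnedChain ω₂ lam β γ).transitionKernel N T T s.toNNReal z))
      ∂((pinnedChain ω₂ lam β γ).gibbsMeasure N T)
  else 0

/-- The equilibrium bond-heat variance `V_N(b,t) = 2∫₀ᵗ (t-s) C_N(b,s) ds` of the crux (verbatim). -/
def bondHeatVariance (ω₂ lam β γ T : ℝ) (N b : ℕ) (t : ℝ) : ℝ :=
  2 * ∫ s in (0 : ℝ)..t, (t - s) * eqCurrentAutocorr ω₂ lam β γ T N b s

/-! ### Elementary facts about the vocabulary -/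

theorem swapObs_swapObs (N : ℕ) (p : Obs N) : swapObs N (swapObs N p) = p := rfl

theorem flipObs_swapObs (N : ℕ) (p : Obs N) : flipObs N (swapObs N p) = swapObs N (flipObs N p) :=
  rfl

theorem flipObs_involutive (N : ℕ) : Function.Involutive (flipObs N) := by
  rintro ⟨x, y, u, v, e⟩
  simp [flipObs]

theorem measurable_swapObs (N : ℕ) : Measurable (swapObs N) := by
  unfold swapObs
  fun_prop

theorem measurable_flipObs (N : ℕ) : Measurable (flipObs N) := by
  unfold flipObs
  fun_prop

/-- The bond heat is exactly odd under `Θ̃`. -/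
theorem bondCoord_flipObs (N : ℕ) (p : Obs N) : (flipObs N p).2.2.2.2 = -p.2.2.2.2 := rfl

/-- The bath heats are exactly odd under `Θ̃`. -/
theorem leftHeat_flipObs {N : ℕ} (i0 : Fin N) (p : Obs N) :
    leftHeat i0 (flipObs N p) = -leftHeat i0 p := by
  simp only [leftHeat, flipObs, Pi.neg_apply]
  ring

/-! ## The two closed slots -/

theorem k1_slot_closed_by_landed_theorem :
  ∀ ω₂ lam β γ : ℝ, 0 < ω₂ → 0 < lam → 0 < β → 0 < γ →
  ∀ (N : ℕ) (i0 iN ib : Fin N), 2 ≤ N → i0.val = 0 → iN.val = N - 1 →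
  ∀ (T_L T_R : ℝ), 0 < T_L → 0 < T_R → ∀ t : ℝ, 0 < t →
  ∀ G : Obs N → ℝ≥0∞, Measurable G →
    ∫⁻ z, ∫⁻ w, G (swapObs N (rawObs (pinnedChain ω₂ lam β γ) N i0 iN ib t z
        (fwdPath (pinnedChain ω₂ lam β γ) N T_L T_R z w))) ∂wienerPair =
      ENNReal.ofReal (Real.exp (2 * γ * t)) *
        ∫⁻ y, ∫⁻ w, G (rawObs (pinnedChain ω₂ lam β γ) N i0 iN ib t y
          (revPath (pinnedChain ω₂ lam β γ) N T_L T_R y w)) ∂wienerPair :=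
  Summit.AtomisticToContinuum.FouriersLaw.Theorems.LinearResponseFTUR.stub_pathLebesgueDuality

theorem k6a_slot_closed_by_landed_theorem :
  ∀ ω₂ lam β γ : ℝ, 0 < ω₂ → 0 < lam → 0 < β → 0 < γ →
  (∀ (N : ℕ) (T_L T_R : ℝ), 0 < T_L → 0 < T_R → ∀ μ ν : Measure (PhaseSpace N),
    (pinnedChain ω₂ lam β γ).IsSteadyState N T_L T_R μ →
    (pinnedChain ω₂ lam β γ).IsSteadyState N T_L T_R ν → μ = ν) →
  ∀ μ : (N : ℕ) → ℝ → ℝ → Measure (PhaseSpace N),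
    (∀ (N : ℕ) (T_L T_R : ℝ), 0 < T_L → 0 < T_R →
      (pinnedChain ω₂ lam β γ).IsSteadyState N T_L T_R (μ N T_L T_R)) →
  ∀ T : ℝ, 0 < T → ∀ (N : ℕ) (i0 iN ib : Fin N), 2 ≤ N → i0.val = 0 → iN.val = N - 1 →
    ib.val + 1 < N → ∀ t : ℝ, 0 < t →
    MemLp (fun p : Obs N => p.2.2.2.2) 2 (fluxLaw (pinnedChain ω₂ lam β γ) N i0 iN ib T T t (μ N T T)) ∧
    variance (fun p : Obs N => p.2.2.2.2) (fluxLaw (pinnedChain ω₂ lam β γ) N i0 iN ib T T t (μ N T T)) =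
      bondHeatVariance ω₂ lam β γ T N ib.val t :=
  Summit.AtomisticToContinuum.FouriersLaw.Theorems.LinearResponseFTUR.stub_equilibriumBondHeatVariance

end Summit.AtomisticToContinuum.FouriersLaw.Cruxes.LinearResponseFTUR.DrefuteG2Bridge

end
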